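import Summits.CriticalPhenomena.PercolationContinuityZ3.Theorems.PercNearOneGluingNoHeavyQuantGluedDomination
import HarnessLib

/-!
# QUANT lane R8, T-DEC: LOCAL TRANSFER for the glued-piece slice — the images under `t = {0: 1−q, r: q(1−g), r+k: qg}` of the valid components of
# the first factor (points, giant pairs, HEAVY mid pairs) are DEC at the raised target, hence the ABSORBER HALF and the heavy-pair / giant-pair
# conditions of `LawDec.GluedDominated` hold with the pullback itself (arm-1 gen 58, architect)

builds on p205010 (kernel theorem, internal audit signed; external expert review pending)

Support file (`--supports stmt-CriticalPhenomena-4575`), QUANT lane seat prim-quant-arm-1 (gen 58, architect); memo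
`run/shared/lean/prim/quant/prim-quant-arm-1-g58/ARCH-G58.md` §1–§2.  Theorems only; standard axioms, no sorries, no definitions.

THE SINGLE-LAYER ROUTE TO `GluedDominated` (memo §2; census-2 g55's `SliceSingleLayer` transplanted).  A certificate `(α, p)` of `ν_a = gate_a(β ∗ t)` at
`(y, T, j)` (`y = ax`, `T = T₀ + am`, `T₀ = aS`, `m = q(r+kg)`) is to be dominated by taking, at ONE layer `J ≤ B`, the pullback
`Ψ = gluedPullback T q g j r k α p` ITSELF as the price system of the first factor: this needs (i) `Ψ(h) ≤ 0` off the `J`-lows and (ii) the pair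
conditions `Ψ(l) ≤ usage·(−Ψ(h))`.  By weak duality, (i)/(ii) for a component `C` of the first factor valid at `(y, T₀, J)` follow as soon as the IMAGE
`C ∗ t` is DEC at `(y, T, j)` ("local transfer").  EXACT CENSUS (memo §1, explore/local_census.py): local transfer holds for every valid component EXCEPT the
tight LIGHT mid pairs `{l, h; γ < y}` with `h + r + k > j` (light WINDOW pairs).  THIS FILE proves the transferring classes that need no case analysis:

* `flowAtT_of_tail_ge` — a probability law whose mass above the layer is `≥ y` has a flow at every target (criterion E).
* **`sdec_glued`** — the glued law `t` alone is SDEC at every floor `x ≤ qg` (its top atom `r+k` is a giant of mass `≥ qg` at every layer below the top);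
  `decAtT_glued` — hence DEC at `(y, T′, j′)` for every layer and every target `T′ ≤ m` (`y ≤ qg`, `y(r+k) ≤ m`).
* **`glued_shift_decAtT`** — the image `δ_h ∗ t` of a SELF-SUFFICIENT point (`T ≤ 2h + m`, `h ≤ j`) is DEC at `(y, T, j)` (shift of `decAtT_glued`);
  **`glued_window_decAtT`** — so is the image of any atom `h` with `j < h + r + k` (its top copy is a giant of mass `qg ≥ y`);
  **`glued_giantPair_decAtT`** — and the image of a giant pair `{l, h; γ}`, `j < h`, `y ≤ γ`.
* **`glued_heavyPair_decAtT`** — the image of a HEAVY pair `{l, l+K; γ}` (`y ≤ γ ≤ 1`) is DEC at `(y, T, j)` whenever `T ≤ 2l + Kγ + m` (in particular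
  for every heavy component valid at `T₀ = T − am`: credit `2l + Kγ ≥ T₀`): `{l,l+K;γ} ∗ t = δ_l ∗ slice t K γ`, the heavy blob slice of the SDEC law `t`
  (`sdec_slice'`), shifted (`decAtT_shift_two`), target lowered (`decAtT_antitone_target`).
* CONSEQUENCES FOR THE PULLBACK (weak duality `dual_le_of_decAtT` + `glued_functional_eq`): **`gluedPullback_nonpos`** (the ABSORBER HALF: `Ψ(h) ≤ 0` for
  every `h ≤ B` with `T ≤ 2h + m` or `j < h + r + k` — all absorbers of every layer `J ≥ j − r − k`), **`gluedPullback_heavyPair`**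
  (`(1−γ)Ψ(l) + γΨ(l+K) ≤ 0` for heavy pairs as above — the pair condition at the minimal heavy gate), **`gluedPullback_giantPair`**
  (`(1−γ)Ψ(l) + γΨ(h) ≤ 0` for `j < h`, `y ≤ γ`).
WHAT THIS LEAVES of the single-layer route (memo §2): the LIGHT deep pairs (`γ < y`, `h + r + k ≤ j`; transfer holds in the census, proof = a light-blob
slice of `t`, cf. `LightTwoBlobDEC`), the light window pairs below the largest cheap atom (LEMMA W analogue), and the gate row for `a < 1`.

HONEST STATUS.  `GluedDominated`, the band, `SiblingStep`, `FarTreeRow` OPEN; RATE class (log\*) / honest sentence unchanged.  [this work].  Nothing here is cited as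
a published result.  The gluing rows served [cite: KozmaNitzan2024, Conjecture 3 (p. 15)]; product measure [cite: Grimmett1999, §1.3 p. 10].
-/

noncomputable section

open scoped BigOperators

namespace Summit.CriticalPhenomena.PercolationContinuityZ3.Theorems
namespace Quant

open Finset

namespace LawDec

/-- the point mass `δ_K` -/
local notation3 "δ[" K "]" => (fun k : ℕ => if k = (K : ℕ) then (1 : ℝ) else 0)

/-- the two-point law `{lo, lo+K; g}` = `lo` sure relays and a blob of size `K` at gate `g` -/
local notation3 "TPL[" lo ", " K ", " g "]" => lconv lo K δ[lo] (gate δ[K] g)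

/-! ### Criterion E in tail form -/

/-- **a probability law with mass `≥ y` above the layer has a flow at every target** (the lows have mass `≤ 1 − tail`, the giants absorb at rate
`y/(1−y)`; `flowAtT_of_giants`). [this work] -/
theorem flowAtT_of_tail_ge (y T : ℝ) (j M : ℕ) (A : ℕ → ℝ) (hy0 : 0 < y) (hy1 : y < 1) (hA0 : ∀ h, 0 ≤ A h)
(hA1 : ∑ h ∈ Finset.range (M + 1), A h = 1)
    (htail : y ≤ ∑ h ∈ Finset.Ico (j + 1) (M + 1), A h) : FlowAtT y T j M A := by
  refine flowAtT_of_giants y T j M A hy0 hy1 hA0 ?_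
  set G : ℝ := ∑ h ∈ Finset.Ico (j + 1) (M + 1), A h with hG
  have hjM : j + 1 ≤ M + 1 := by
    by_contra hc
    have : G = 0 := by
      rw [hG]; exact Finset.sum_eq_zero fun h hh => by rw [Finset.mem_Ico] at hh; omega
    linarith
  have hsplit : ∑ h ∈ Finset.range (j + 1), A h + G = 1 := by
    rw [hG, Finset.sum_range_add_sum_Ico _ hjM, hA1]
  have hlow : ∑ l ∈ Finset.range (j + 1), (if 2 * (l : ℝ) < T then A l else 0) ≤ 1 - G := by
    have : ∑ l ∈ Finset.range (j + 1), (if 2 * (l : ℝ) < T then A l else 0) ≤ ∑ l ∈ Finset.range (j + 1), A l :=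
      Finset.sum_le_sum fun l _ => by split_ifs <;> linarith [hA0 l]
    linarith
  have h1y : 0 < 1 - y := by linarith
  rw [div_mul_eq_mul_div, div_le_iff₀ h1y]
  nlinarith [mul_le_mul_of_nonneg_left hlow hy0.le]

/-! ### The glued law alone -/

/-- **the glued law `t = gate {r, r+k; g} q` is SDEC at every floor `x ≤ qg`** (`0 < x < 1`, `0 < q ≤ 1`, `0 ≤ g ≤ 1`, `r ≥ 1`): after any outer gate `a`
the top atom `r + k` carries `aq·g ≥ ax` and is a giant at every layer below the top (criterion E). [this work] -/
theorem sdec_glued (x q g : ℝ) (r k : ℕ) (hx0 : 0 < x) (hx1 : x < 1) (hq0 : 0 < q) (hq1 : q ≤ 1) (hg0 : 0 ≤ g) (hg1 : g ≤ 1)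
    (hxqg : x ≤ q * g) : SDEC x (r + k) (gate (TPL[r, k, g]) q) := by
  intro a ha0 ha1 j hj
  obtain ⟨t0, tM, t1, tmn, _⟩ := hs_facts r k g hg0 hg1
  rw [gate_gate]
  obtain ⟨u0, uM, u1⟩ := gate_laws (r + k) (TPL[r, k, g]) (a * q) (by positivity) (by nlinarith) t0 tM t1
  have hy0 : 0 < a * x := mul_pos ha0 hx0
  have hy1 : a * x < 1 := by nlinarith
  rw [decAt_iff_decAtT]
  refine decAtT_of_flowAtT (a * x) _ j (r + k) _ hy0 hy1 uM u1 (flowAtT_of_tail_ge (a * x) _ j (r + k) _ hy0 hy1 u0 u1 ?_)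
  -- the tail contains the atom r + k, of mass a q · (g + (1−g)[k = 0]) ≥ a q g ≥ a x
  have hmem : r + k ∈ Finset.Ico (j + 1) (r + k + 1) := Finset.mem_Ico.2 ⟨by omega, by omega⟩
  have hx' : a * x ≤ a * q * g := by nlinarith [mul_le_mul_of_nonneg_left hxqg ha0.le]
  have h1 : 0 ≤ a * q * (1 - g) := mul_nonneg (mul_nonneg ha0.le hq0.le) (by linarith)
  have htop : a * q * g ≤ gate (TPL[r, k, g]) (a * q) (r + k) := by
    rw [gate_apply, tpLaw_apply, if_pos rfl, if_neg (by omega : r + k ≠ 0)]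
    split_ifs <;> nlinarith [h1]
  exact le_trans hx' (le_trans htop (Finset.single_le_sum (fun h _ => u0 h) hmem))

/-- **the glued law is DEC at every layer and every target `T′ ≤ m = q(r+kg)`** at a floor `0 < y ≤ qg` with `y(r+k) ≤ m` (below the top: `sdec_glued`
with the trivial gate and `decAtT_antitone_target`; at and above the top: Theorem A). [this work] -/
theorem decAtT_glued (y q g T' : ℝ) (r k j : ℕ) (hy0 : 0 < y) (hy1 : y < 1) (hq0 : 0 < q) (hq1 : q ≤ 1) (hg0 : 0 ≤ g) (hg1 : g ≤ 1)
    (hyqg : y ≤ q * g) (haff : y * ((r : ℝ) + k) ≤ q * ((r : ℝ) + k * g)) (hT : T' ≤ q * ((r : ℝ) + k * g)) :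
    DECAtT y T' j (r + k) (gate (TPL[r, k, g]) q) := by
  obtain ⟨t0, tM, t1, tmn⟩ := glued_laws q g r k hq0.le hq1 hg0 hg1
  refine decAtT_antitone_target hT ?_
  rw [← tmn, ← decAt_iff_decAtT]
  rcases Nat.lt_or_ge j (r + k) with hj | hj
  · have := sdec_glued y q g r k hy0 hy1 hq0 hq1 hg0 hg1 hyqg 1 one_pos le_rfl j hj
    rwa [gate_one, one_mul] at this
  · refine decAt_of_top_le (r + k) _ t0 tM t1 y hy1 (fun h hh => ?_) j hj
    have hhM : h ≤ r + k := by
      by_contra hc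
      exact absurd (tM h (not_le.1 hc)) (ne_of_gt hh)
    rw [tmn]
    have : y * (h : ℝ) ≤ y * ((r : ℝ) + k) := by
      have : (h : ℝ) ≤ (r : ℝ) + k := by exact_mod_cast hhM
      exact mul_le_mul_of_nonneg_left this hy0.le
    linarith

/-! ### Images of valid components -/

/-- **the image of a SELF-SUFFICIENT point is DEC at the raised target**: for `h ≤ j` and `T ≤ 2h + m`, the shift `δ_h ∗ t` is DEC at `(y, T, j)` on every top
`M ≥ h + (r+k)` (`decAtT_glued` at target `T − 2h ≤ m`, layer `j − h`, shifted by `h`). [this work] -/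
theorem glued_shift_decAtT (y q g T : ℝ) (r k j h M : ℕ) (hy0 : 0 < y) (hy1 : y < 1) (hq0 : 0 < q) (hq1 : q ≤ 1) (hg0 : 0 ≤ g) (hg1 : g ≤ 1)
    (hyqg : y ≤ q * g) (haff : y * ((r : ℝ) + k) ≤ q * ((r : ℝ) + k * g)) (hhj : h ≤ j) (hM : h + (r + k) ≤ M)
    (hT : T ≤ 2 * (h : ℝ) + q * ((r : ℝ) + k * g)) :
    DECAtT y T j M (fun u => if h ≤ u then gate (TPL[r, k, g]) q (u - h) else 0) := by
  have base := decAtT_glued y q g (T - 2 * (h : ℝ)) r k (j - h) hy0 hy1 hq0 hq1 hg0 hg1 hyqg haff (by linarith)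
  have sh := decAtT_shift_two y (T - 2 * (h : ℝ)) (j - h) (r + k) h _ base
  rw [show T - 2 * (h : ℝ) + 2 * (h : ℝ) = T by ring, show j - h + h = j by omega] at sh
  exact decAtT_mono_top sh (by omega)

/-- the image of a point as a convolution: `lconv B (r+k) δ_h t = δ_h ∗ t` (shift by `h ≤ B`). [this work] -/
theorem lconv_point_glued (B r k h : ℕ) (q g : ℝ) (hg0 : 0 ≤ g) (hg1 : g ≤ 1) (hhB : h ≤ B) (u : ℕ) :
    lconv B (r + k) δ[h] (gate (TPL[r, k, g]) q) u = if h ≤ u then gate (TPL[r, k, g]) q (u - h) else 0 := by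
  obtain ⟨_, tM, _, _, _⟩ := hs_facts r k g hg0 hg1
  have uM' : ∀ i, r + k < i → gate (TPL[r, k, g]) q i = 0 := by
    intro i hi; rw [gate_apply, tM i hi, if_neg (by omega)]; ring
  rw [lconv_top_left_of_le h B (r + k) δ[h] _ hhB (fun i hi => if_neg (by omega)) u]
  exact lconv_point_left h (r + k) _ uM' u

/-- **the image of a WINDOW atom is DEC**: for `h ≤ B` with `j < h + r + k` the image `δ_h ∗ t` has its top copy `h + r + k` above the layer with mass
`q·g ≥ y` (criterion E), for every target. [this work] -/
theorem glued_window_decAtT (y q g T : ℝ) (r k j h B : ℕ) (hy0 : 0 < y) (hy1 : y < 1) (hq0 : 0 < q) (hq1 : q ≤ 1) (hg0 : 0 ≤ g) (hg1 : g ≤ 1)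
    (hr : 1 ≤ r) (hyqg : y ≤ q * g) (hhB : h ≤ B) (hwin : j < h + r + k) :
    DECAtT y T j (B + (r + k)) (lconv B (r + k) δ[h] (gate (TPL[r, k, g]) q)) := by
  obtain ⟨t0, tM, t1, tmn⟩ := glued_laws q g r k hq0.le hq1 hg0 hg1
  have d1 : ∑ i ∈ Finset.range (h + 1), δ[h] i = 1 := by simp
  have A0 : ∀ u, 0 ≤ lconv B (r + k) δ[h] (gate (TPL[r, k, g]) q) u :=
    lconv_nonneg B (r + k) _ _ (fun i => by positivity) t0
  have AM : ∀ u, B + (r + k) < u → lconv B (r + k) δ[h] (gate (TPL[r, k, g]) q) u = 0 := fun u hu => lconv_eq_zero B (r + k) _ _ u hu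
  have A1 : ∑ u ∈ Finset.range (B + (r + k) + 1), lconv B (r + k) δ[h] (gate (TPL[r, k, g]) q) u = 1 := by
    have d1' : ∑ i ∈ Finset.range (B + 1), δ[h] i = 1 := by
      rw [Finset.sum_ite_eq' (Finset.range (B + 1)) h, if_pos (Finset.mem_range.2 (by omega))]
    exact sum_lconv B (r + k) _ _ d1' t1
  refine decAtT_of_flowAtT y T j (B + (r + k)) _ hy0 hy1 AM A1 (flowAtT_of_tail_ge y T j (B + (r + k)) _ hy0 hy1 A0 A1 ?_)
  have hmem : h + (r + k) ∈ Finset.Ico (j + 1) (B + (r + k) + 1) := Finset.mem_Ico.2 ⟨by omega, by omega⟩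
  refine le_trans ?_ (Finset.single_le_sum (fun u _ => A0 u) hmem)
  rw [lconv_point_glued B r k h q g hg0 hg1 hhB, if_pos (by omega), show h + (r + k) - h = r + k by omega,
    gate_apply, tpLaw_apply, if_pos rfl, if_neg (by omega : r + k ≠ 0)]
  have h1 : 0 ≤ q * (1 - g) := mul_nonneg hq0.le (by linarith)
  split_ifs <;> nlinarith [h1]

/-- **the image of a GIANT PAIR is DEC**: `{l, h; γ}` with `j < h ≤ B`, `l ≤ B` and `y ≤ γ ≤ 1`: the copies of `h` lie above the layer and carry `γ ≥ y`
(criterion E), for every target. [this work] -/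
theorem glued_giantPair_decAtT (y q g T γ : ℝ) (r k j l h B : ℕ) (hy0 : 0 < y) (hy1 : y < 1) (hq0 : 0 < q) (hq1 : q ≤ 1) (hg0 : 0 ≤ g) (hg1 : g ≤ 1)
    (hγ : y ≤ γ) (hγ1 : γ ≤ 1) (hlB : l ≤ B) (hhB : h ≤ B) (hjh : j < h) :
    DECAtT y T j (B + (r + k)) (lconv B (r + k) (fun i => γ * δ[h] i + (1 - γ) * δ[l] i) (gate (TPL[r, k, g]) q)) := by
  obtain ⟨t0, tM, t1, tmn⟩ := glued_laws q g r k hq0.le hq1 hg0 hg1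
  set A : ℕ → ℝ := lconv B (r + k) (fun i => γ * δ[h] i + (1 - γ) * δ[l] i) (gate (TPL[r, k, g]) q) with hA
  have c0 : ∀ i, 0 ≤ γ * δ[h] i + (1 - γ) * δ[l] i := fun i => by
    have : 0 ≤ γ := hy0.le.trans hγ
    positivity
  have c1 : ∑ i ∈ Finset.range (B + 1), (γ * δ[h] i + (1 - γ) * δ[l] i) = 1 := by
    rw [Finset.sum_add_distrib, ← Finset.mul_sum, ← Finset.mul_sum, Finset.sum_ite_eq' (Finset.range (B + 1)) h,
      Finset.sum_ite_eq' (Finset.range (B + 1)) l, if_pos (Finset.mem_range.2 (by omega)), if_pos (Finset.mem_range.2 (by omega))]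
    ring
  have A0 : ∀ u, 0 ≤ A u := lconv_nonneg B (r + k) _ _ c0 t0
  have AM : ∀ u, B + (r + k) < u → A u = 0 := fun u hu => lconv_eq_zero B (r + k) _ _ u hu
  have A1 : ∑ u ∈ Finset.range (B + (r + k) + 1), A u = 1 := sum_lconv B (r + k) _ _ c1 t1
  refine decAtT_of_flowAtT y T j (B + (r + k)) A hy0 hy1 AM A1 (flowAtT_of_tail_ge y T j (B + (r + k)) A hy0 hy1 A0 A1 ?_)
  -- the tail contains γ · (the whole shifted copy δ_h ∗ t)
  have hsplit : ∀ u, A u = γ * lconv B (r + k) δ[h] (gate (TPL[r, k, g]) q) u + (1 - γ) * lconv B (r + k) δ[l] (gate (TPL[r, k, g]) q) u :=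
    fun u => by rw [hA, lconv_lin_left]
  have hle : ∀ u, γ * lconv B (r + k) δ[h] (gate (TPL[r, k, g]) q) u ≤ A u := fun u => by
    rw [hsplit u]
    have : 0 ≤ (1 - γ) * lconv B (r + k) δ[l] (gate (TPL[r, k, g]) q) u :=
      mul_nonneg (by linarith) (lconv_nonneg B (r + k) _ _ (fun i => by positivity) t0 u)
    linarith
  have hfull : ∑ u ∈ Finset.Ico (j + 1) (B + (r + k) + 1), lconv B (r + k) δ[h] (gate (TPL[r, k, g]) q) u = 1 := by
    have d1' : ∑ i ∈ Finset.range (B + 1), δ[h] i = 1 := by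
      rw [Finset.sum_ite_eq' (Finset.range (B + 1)) h, if_pos (Finset.mem_range.2 (by omega))]
    have tot := sum_lconv B (r + k) δ[h] _ d1' t1
    rw [← Finset.sum_range_add_sum_Ico _ (by omega : j + 1 ≤ B + (r + k) + 1)] at tot
    have hz : ∑ u ∈ Finset.range (j + 1), lconv B (r + k) δ[h] (gate (TPL[r, k, g]) q) u = 0 :=
      Finset.sum_eq_zero fun u hu => by
        rw [lconv_point_glued B r k h q g hg0 hg1 hhB, if_neg (by rw [Finset.mem_range] at hu; omega)]
    linarith
  calc y ≤ γ := hγ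
    _ = ∑ u ∈ Finset.Ico (j + 1) (B + (r + k) + 1), γ * lconv B (r + k) δ[h] (gate (TPL[r, k, g]) q) u := by
        rw [← Finset.mul_sum, hfull, mul_one]
    _ ≤ ∑ u ∈ Finset.Ico (j + 1) (B + (r + k) + 1), A u := Finset.sum_le_sum fun u _ => hle u

/-- the image of a pair as a shifted slice: `{l, l+K; γ} ∗ t = δ_l ∗ slice t K γ` on any top `B ≥ l + K`. [this work] -/
theorem lconv_pair_glued (B r k l K : ℕ) (q g γ : ℝ) (hg0 : 0 ≤ g) (hg1 : g ≤ 1) (hB : l + K ≤ B) (u : ℕ) :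
    lconv B (r + k) (TPL[l, K, γ]) (gate (TPL[r, k, g]) q) u
      = if l ≤ u then slice (gate (TPL[r, k, g]) q) K γ (u - l) else 0 := by
  obtain ⟨_, tM, _, _, _⟩ := hs_facts r k g hg0 hg1
  have uM' : ∀ i, r + k < i → gate (TPL[r, k, g]) q i = 0 := by
    intro i hi; rw [gate_apply, tM i hi, if_neg (by omega)]; ring
  rw [lconv_top_left_of_le (l + K) B (r + k) (TPL[l, K, γ]) _ hB (fun i hi => ?_) u]
  · rw [← lconv_assoc l K (r + k) δ[l] (gate δ[K] γ) (gate (TPL[r, k, g]) q),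
      lconv_point_left l (K + (r + k)) _ (fun i hi => lconv_eq_zero K (r + k) _ _ i hi) u]
    by_cases hlu : l ≤ u
    · rw [if_pos hlu, if_pos hlu, lconv_comm K (r + k), lconv_gate_point_eq_slice (r + k) K _ γ uM']
    · rw [if_neg hlu, if_neg hlu]
  · exact lconv_eq_zero l K _ _ i hi

/-- **the image of a HEAVY pair is DEC at the raised target**: `{l, l+K; γ}` with `y ≤ γ ≤ 1`, `l ≤ j`, `l + K ≤ B`, and `T ≤ 2l + Kγ + m` (every heavy
component valid at `T − Δ`, `Δ ≤ m`, qualifies: credit `2l + Kγ ≥ T − Δ`).  The image is `δ_l ∗ slice t K γ`; `slice t K γ` is SDEC at `y`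
(`sdec_glued`, `sdec_slice'`), so DEC at `(y, m + Kγ, j − l)`, target lowered to `T − 2l`, shifted by `l`. [this work] -/
theorem glued_heavyPair_decAtT (y q g T γ : ℝ) (r k j l K B : ℕ) (hy0 : 0 < y) (hy1 : y < 1) (hq0 : 0 < q) (hq1 : q ≤ 1) (hg0 : 0 ≤ g)
    (hg1 : g ≤ 1) (hyqg : y ≤ q * g) (haff : y * ((r : ℝ) + k) ≤ q * ((r : ℝ) + k * g)) (hγ : y ≤ γ) (hγ1 : γ ≤ 1) (hlj : l ≤ j)
    (hB : l + K ≤ B) (hT : T ≤ 2 * (l : ℝ) + (K : ℝ) * γ + q * ((r : ℝ) + k * g)) :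
    DECAtT y T j (B + (r + k)) (lconv B (r + k) (TPL[l, K, γ]) (gate (TPL[r, k, g]) q)) := by
  obtain ⟨t0, tM, t1, tmn⟩ := glued_laws q g r k hq0.le hq1 hg0 hg1
  set t : ℕ → ℝ := gate (TPL[r, k, g]) q with ht
  have hS : SDEC y (r + k) t := sdec_glued y q g r k hy0 hy1 hq0 hq1 hg0 hg1 hyqg
  have hta : y * ((r + k : ℕ) : ℝ) ≤ ∑ h ∈ Finset.range (r + k + 1), (h : ℝ) * t h := by rw [tmn]; push_cast; exact haff
  have hSl : SDEC y (r + k + K) (slice t K γ) := sdec_slice' y γ (r + k) K t hy0 hy1 hγ hγ1 t0 tM t1 hta hS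
  have s0 : ∀ h, 0 ≤ slice t K γ h := slice_nonneg t K γ (hy0.le.trans hγ) hγ1 t0
  have sM : ∀ h, r + k + K < h → slice t K γ h = 0 := slice_eq_zero t K γ (r + k) tM
  have s1 := sum_slice t K γ (r + k) tM t1
  have smean : ∑ h ∈ Finset.range (r + k + K + 1), (h : ℝ) * slice t K γ h = q * ((r : ℝ) + k * g) + (K : ℝ) * γ := by
    rw [sum_mul_slice t K γ (r + k) tM t1, tmn]
  -- DEC of the slice at (y, T − 2l, j − l)
  have base : DECAtT y (T - 2 * (l : ℝ)) (j - l) (r + k + K) (slice t K γ) := by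
    refine decAtT_antitone_target (show T - 2 * (l : ℝ) ≤ q * ((r : ℝ) + k * g) + (K : ℝ) * γ by linarith) ?_
    rw [← smean, ← decAt_iff_decAtT]
    rcases Nat.lt_or_ge (j - l) (r + k + K) with hj | hj
    · have := hSl 1 one_pos le_rfl (j - l) hj
      rwa [gate_one, one_mul] at this
    · refine decAt_of_top_le (r + k + K) _ s0 sM s1 y hy1 (fun h hh => ?_) (j - l) hj
      have hhM : h ≤ r + k + K := by
        by_contra hc
        exact absurd (sM h (not_le.1 hc)) (ne_of_gt hh)
      rw [smean]
      have h1 : y * (h : ℝ) ≤ y * ((r + k + K : ℕ) : ℝ) := mul_le_mul_of_nonneg_left (by exact_mod_cast hhM) hy0.le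
      have h2 : y * (K : ℝ) ≤ (K : ℝ) * γ := by
        have hK0 : (0 : ℝ) ≤ (K : ℝ) := Nat.cast_nonneg K
        nlinarith
      push_cast at h1
      nlinarith
  have sh := decAtT_shift_two y (T - 2 * (l : ℝ)) (j - l) (r + k + K) l _ base
  rw [show T - 2 * (l : ℝ) + 2 * (l : ℝ) = T by ring, show j - l + l = j by omega] at sh
  have e : lconv B (r + k) (TPL[l, K, γ]) t = fun u => if l ≤ u then slice t K γ (u - l) else 0 :=
    funext fun u => lconv_pair_glued B r k l K q g γ hg0 hg1 hB u
  rw [e]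
  exact decAtT_mono_top sh (by omega)

/-! ### Consequences for the pullback (weak duality) -/

/-- the value of a certificate on the image of a law `C` on `{0..B}`: `Σ_u e(u)·(C ∗ t)(u) = Σ_h C(h)·Ψ(h)`. [this work] -/
theorem glued_image_functional (B r k : ℕ) (C : ℕ → ℝ) (q g T : ℝ) (j : ℕ) (α p : ℕ → ℝ) (hr : 1 ≤ r) :
    ∑ u ∈ Finset.range (B + (r + k) + 1), coefAt T j α p u * lconv B (r + k) C (gate (TPL[r, k, g]) q) u
      = ∑ h ∈ Finset.range (B + 1), C h * gluedPullback T q g j r k α p h := by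
  have := glued_functional_eq B r k C (coefAt T j α p) q g 1 hr
  simp only [gate_one, sub_self, zero_mul, zero_add, one_mul] at this
  rw [this]
  rfl

/-- weak duality on an image: if `C ≥ 0` on `{0..B}` has mass `1` and `C ∗ t` is DEC at `(y, T, j)` on `{0..B+(r+k)}`, every price system `(α, p)` of the
positions at `(y, T, j)` has `Σ_h C(h)·Ψ(h) ≤ 0`. [this work] -/
theorem glued_image_dual_le (y q g T : ℝ) (r k j B : ℕ) (C α p : ℕ → ℝ) (hy0 : 0 < y) (hy1 : y < 1)
    (hr : 1 ≤ r) (hjM : j ≤ B + (r + k))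
    (hdec : DECAtT y T j (B + (r + k)) (lconv B (r + k) C (gate (TPL[r, k, g]) q)))
    (hp : ∀ h, 0 ≤ p h)
    (hαp : ∀ l h, l ≤ j → 2 * (l : ℝ) < T → h ≤ B + (r + k) → (j + 1 ≤ h ∨ T < (l : ℝ) + h) → α l ≤ usage y T j l h * p h) :
    ∑ h ∈ Finset.range (B + 1), C h * gluedPullback T q g j r k α p h ≤ 0 := by
  have wd := dual_le_of_decAtT y T j (B + (r + k)) _ hy0 hy1 hdec α p hp hαp
  have eq := dual_functional_eq T j (B + (r + k)) α p (lconv B (r + k) C (gate (TPL[r, k, g]) q)) hjM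
  rw [glued_image_functional B r k C q g T j α p hr] at eq
  linarith

/-- **THE ABSORBER HALF.**  For a price system `(α, p)` of the positions `{0..B+(r+k)}` at `(y, T, j)` (`0 < y ≤ qg`, `y(r+k) ≤ m`), every atom `h ≤ B` with
`T ≤ 2h + m` (self-sufficient at `T − Δ` for any `Δ ≤ m`, e.g. every mid of the first factor) or `j < h + r + k` (every atom above `j − r − k`) has
`Ψ(h) ≤ 0`. [this work] -/
theorem gluedPullback_nonpos (y q g T : ℝ) (r k j B h : ℕ) (α p : ℕ → ℝ) (hy0 : 0 < y) (hy1 : y < 1) (hq0 : 0 < q) (hq1 : q ≤ 1)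
    (hg0 : 0 ≤ g) (hg1 : g ≤ 1) (hr : 1 ≤ r) (hyqg : y ≤ q * g) (haff : y * ((r : ℝ) + k) ≤ q * ((r : ℝ) + k * g)) (hjM : j < B + (r + k))
    (hhB : h ≤ B) (habs : T ≤ 2 * (h : ℝ) + q * ((r : ℝ) + k * g) ∨ j < h + r + k)
    (hp : ∀ h, 0 ≤ p h)
    (hαp : ∀ l h, l ≤ j → 2 * (l : ℝ) < T → h ≤ B + (r + k) → (j + 1 ≤ h ∨ T < (l : ℝ) + h) → α l ≤ usage y T j l h * p h) :
    gluedPullback T q g j r k α p h ≤ 0 := by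
  have hdec : DECAtT y T j (B + (r + k)) (lconv B (r + k) δ[h] (gate (TPL[r, k, g]) q)) := by
    rcases habs with hT | hwin
    · by_cases hhj : h ≤ j
      · have e : lconv B (r + k) δ[h] (gate (TPL[r, k, g]) q) = fun u => if h ≤ u then gate (TPL[r, k, g]) q (u - h) else 0 :=
          funext fun u => lconv_point_glued B r k h q g hg0 hg1 hhB u
        rw [e]
        exact glued_shift_decAtT y q g T r k j h (B + (r + k)) hy0 hy1 hq0 hq1 hg0 hg1 hyqg haff hhj (by omega) hT
      · exact glued_window_decAtT y q g T r k j h B hy0 hy1 hq0 hq1 hg0 hg1 hr hyqg hhB (by omega)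
    · exact glued_window_decAtT y q g T r k j h B hy0 hy1 hq0 hq1 hg0 hg1 hr hyqg hhB hwin
  have d1 : ∑ i ∈ Finset.range (B + 1), δ[h] i = 1 := by
    rw [Finset.sum_ite_eq' (Finset.range (B + 1)) h, if_pos (Finset.mem_range.2 (by omega))]
  have := glued_image_dual_le y q g T r k j B δ[h] α p hy0 hy1 hr hjM.le hdec hp hαp
  have ev : ∑ i ∈ Finset.range (B + 1), δ[h] i * gluedPullback T q g j r k α p i = gluedPullback T q g j r k α p h := by
    have e2 : ∀ i ∈ Finset.range (B + 1), δ[h] i * gluedPullback T q g j r k α p i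
        = gluedPullback T q g j r k α p i * (if i = h then (1 : ℝ) else 0) := by
      intro i _; beta_reduce; ring
    rw [Finset.sum_congr rfl e2]
    exact sum_mul_indicator _ B h hhB
  linarith

/-- the value of the pullback on a two-point law. [this work] -/
theorem sum_pair_gluedPullback (B l h : ℕ) (γ : ℝ) (Ψ : ℕ → ℝ) (hlB : l ≤ B) (hhB : h ≤ B) :
    ∑ i ∈ Finset.range (B + 1), (γ * δ[h] i + (1 - γ) * δ[l] i) * Ψ i = (1 - γ) * Ψ l + γ * Ψ h := by
  have e2 : ∀ i ∈ Finset.range (B + 1), (γ * δ[h] i + (1 - γ) * δ[l] i) * Ψ i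
      = γ * (Ψ i * (if i = h then (1 : ℝ) else 0)) + (1 - γ) * (Ψ i * (if i = l then (1 : ℝ) else 0)) := by
    intro i _; beta_reduce; ring
  rw [Finset.sum_congr rfl e2, Finset.sum_add_distrib, ← Finset.mul_sum, ← Finset.mul_sum, sum_mul_indicator Ψ B h hhB,
    sum_mul_indicator Ψ B l hlB]
  ring

/-- **THE HEAVY-PAIR CONDITION.**  For a price system as in `gluedPullback_nonpos` and a heavy pair `{l, l+K; γ}` (`y ≤ γ ≤ 1`, `l ≤ j`, `l + K ≤ B`) with
`T ≤ 2l + Kγ + m`: `(1−γ)·Ψ(l) + γ·Ψ(l+K) ≤ 0` — at the minimal heavy gate `γ = pairGate y T₀ l (l+K)` this is the pair condition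
`Ψ(l) ≤ usage·(−Ψ(l+K))` of the first factor at any target `T₀ ≥ T − m`. [this work] -/
theorem gluedPullback_heavyPair (y q g T γ : ℝ) (r k j B l K : ℕ) (α p : ℕ → ℝ) (hy0 : 0 < y) (hy1 : y < 1) (hq0 : 0 < q) (hq1 : q ≤ 1)
    (hg0 : 0 ≤ g) (hg1 : g ≤ 1) (hr : 1 ≤ r) (hyqg : y ≤ q * g) (haff : y * ((r : ℝ) + k) ≤ q * ((r : ℝ) + k * g)) (hjM : j < B + (r + k))
    (hγ : y ≤ γ) (hγ1 : γ ≤ 1) (hlj : l ≤ j) (hB : l + K ≤ B) (hT : T ≤ 2 * (l : ℝ) + (K : ℝ) * γ + q * ((r : ℝ) + k * g))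
    (hp : ∀ h, 0 ≤ p h)
    (hαp : ∀ l h, l ≤ j → 2 * (l : ℝ) < T → h ≤ B + (r + k) → (j + 1 ≤ h ∨ T < (l : ℝ) + h) → α l ≤ usage y T j l h * p h) :
    (1 - γ) * gluedPullback T q g j r k α p l + γ * gluedPullback T q g j r k α p (l + K) ≤ 0 := by
  have hdec := glued_heavyPair_decAtT y q g T γ r k j l K B hy0 hy1 hq0 hq1 hg0 hg1 hyqg haff hγ hγ1 hlj hB hT
  have eC : (TPL[l, K, γ]) = fun i => γ * δ[l + K] i + (1 - γ) * δ[l] i := funext fun i => tpLaw_apply l K γ i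
  rw [eC] at hdec
  have c1 : ∑ i ∈ Finset.range (B + 1), (γ * δ[l + K] i + (1 - γ) * δ[l] i) = 1 := by
    rw [Finset.sum_add_distrib, ← Finset.mul_sum, ← Finset.mul_sum, Finset.sum_ite_eq' (Finset.range (B + 1)) (l + K),
      Finset.sum_ite_eq' (Finset.range (B + 1)) l, if_pos (Finset.mem_range.2 (by omega)), if_pos (Finset.mem_range.2 (by omega))]
    ring
  have := glued_image_dual_le y q g T r k j B _ α p hy0 hy1 hr hjM.le hdec hp hαp
  rwa [sum_pair_gluedPullback B l (l + K) γ _ (by omega) hB] at this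

/-- **THE GIANT-PAIR CONDITION above the layer `j`.**  For a price system as above and `{l, h; γ}` with `j < h ≤ B`, `l ≤ B`, `y ≤ γ ≤ 1`:
`(1−γ)·Ψ(l) + γ·Ψ(h) ≤ 0`; at `γ = y` this is `Ψ(l) ≤ y/(1−y)·(−Ψ(h))`. [this work] -/
theorem gluedPullback_giantPair (y q g T γ : ℝ) (r k j B l h : ℕ) (α p : ℕ → ℝ) (hy0 : 0 < y) (hy1 : y < 1) (hq0 : 0 < q) (hq1 : q ≤ 1)
    (hg0 : 0 ≤ g) (hg1 : g ≤ 1) (hr : 1 ≤ r) (hjM : j < B + (r + k)) (hγ : y ≤ γ) (hγ1 : γ ≤ 1) (hlB : l ≤ B) (hhB : h ≤ B) (hjh : j < h)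
    (hp : ∀ h, 0 ≤ p h)
    (hαp : ∀ l h, l ≤ j → 2 * (l : ℝ) < T → h ≤ B + (r + k) → (j + 1 ≤ h ∨ T < (l : ℝ) + h) → α l ≤ usage y T j l h * p h) :
    (1 - γ) * gluedPullback T q g j r k α p l + γ * gluedPullback T q g j r k α p h ≤ 0 := by
  have hdec := glued_giantPair_decAtT y q g T γ r k j l h B hy0 hy1 hq0 hq1 hg0 hg1 hγ hγ1 hlB hhB hjh
  have c1 : ∑ i ∈ Finset.range (B + 1), (γ * δ[h] i + (1 - γ) * δ[l] i) = 1 := by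
    rw [Finset.sum_add_distrib, ← Finset.mul_sum, ← Finset.mul_sum, Finset.sum_ite_eq' (Finset.range (B + 1)) h,
      Finset.sum_ite_eq' (Finset.range (B + 1)) l, if_pos (Finset.mem_range.2 (by omega)), if_pos (Finset.mem_range.2 (by omega))]
    ring
  have := glued_image_dual_le y q g T r k j B _ α p hy0 hy1 hr hjM.le hdec hp hαp
  rwa [sum_pair_gluedPullback B l h γ _ hlB hhB] at this

end LawDec
end Quant
end Summit.CriticalPhenomena.PercolationContinuityZ3.Theorems
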